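import Summits.AtomisticToContinuum.Crystallization.Theorems.DisclinationRationFiveFoldRationFrontEnd
import Summits.AtomisticToContinuum.Crystallization.Theorems.DisclinationRationFiveFoldRationStubLayerBootstrap
import Summits.AtomisticToContinuum.Crystallization.Theorems.DisclinationRationFiveFoldRationStubCubic
import Summits.AtomisticToContinuum.Crystallization.Theorems.FiveFoldRation.Negative.WithoutGood

/-!
# `FiveFoldRation` (stmt-AtomisticToContinuum-15799), negative side: the conclusion of the open core
# stub of line `Sketch` is not a tautology

Line `Sketch` (lead prover-line-stmt-AtomisticToContinuum-15799-0) has ONE open stub,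
`stub_dr5_core : ∀ δ > 0, ∀ S, IsAdmissible δ S → FrontEnd S → LayerInequality S`, and the lead's memo
offers the stronger target `… → LinearAxisCensusAt S`.  Hypothesis bookkeeping for that stub:

* `densityZero_of_layerInequality` — for a separated `S`, `LayerInequality S` ALREADY gives the crux's
  conclusion for `S` (axis sites have density zero uniformly on balls), by the two LANDED stubs
  `stub_dr5_cubic` (packing) and `stub_dr5_layerBootstrap` (bootstrap); this is the per-`S` content of the
  lead's `FiveFoldRation_of`, isolated so that it can be used contrapositively.
* `not_layerInequality_cubic`, `not_linearAxisCensusAt_cubic` — consequently both candidate conclusions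
  of the core are FALSE on the simple cubic lattice `ℤ³ = Set.range intVec` (`1`-separated, covering
  radius `2`, shell symmetric, but every site is an axis site in the sense of `axisSites` because no
  six-point shell is {fcc,hcp}-good: `cubic_axisSites_eq`).  So neither `LayerInequality S` nor
  `LinearAxisCensusAt S` can be obtained from separation + relative density + profile algebra alone: every
  proof of the core must use everywhere-goodness (through `FrontEnd`'s columns/links) — the same
  load-bearing hypothesis as for the crux itself (`fiveFoldRation_false_without_good`, this directory).

Negative-side support of crux stmt-AtomisticToContinuum-15799 (no route item is concluded positively; no
new definition); refuter seat refuter-cdisprove-stmt-AtomisticToContinuum-15799-g2-0, cycle 2, 2026-08-17.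
-/

noncomputable section

namespace Summit.AtomisticToContinuum.Crystallization.Theorems.FiveFoldRation.Negative

open Literature.Geometry.DiscreteGeometry
open Summit.AtomisticToContinuum.Crystallization.Theorems
open Summit.AtomisticToContinuum.Crystallization.Theorems.FiveFoldRation

/-- **Per-`S` bridge, isolated**: for a `δ`-separated `S`, the layer inequality (conclusion of the open
core stub) implies that the axis sites of `S` have density zero uniformly on balls — packing bound
`stub_dr5_cubic` + bootstrap `stub_dr5_layerBootstrap`, exactly as inside the lead's `FiveFoldRation_of`.
[folklore] -/
theorem densityZero_of_layerInequality {δ : ℝ} (hδ : 0 < δ) {S : Set E3}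
    (hsep : ∀ y ∈ S, ∀ z ∈ S, y ≠ z → δ ≤ dist y z) (hL : LayerInequality S) :
    ∀ θ : ℝ, 0 < θ → ∃ L₀ : ℝ, ∀ L : ℝ, L₀ ≤ L → ∀ c : E3, axisCount S c L ≤ θ * L ^ 3 := by
  intro θ hθ
  obtain ⟨C₁, W₀, hlayer⟩ := hL
  obtain ⟨hfin, C₀, hcub⟩ := stub_dr5_cubic δ hδ S hsep
  obtain ⟨ρ₀, hρ₀⟩ := stub_dr5_layerBootstrap C₀ C₁ W₀ θ hθ
  refine ⟨ρ₀, fun L hL c => ?_⟩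
  have hAxS : axisSites S ⊆ S := fun y hy => hy.1
  have hfinA : ∀ r : ℝ, (axisSites S ∩ Metric.closedBall c r).Finite := fun r =>
    (hfin c r).subset (Set.inter_subset_inter_left _ hAxS)
  have hmono : Monotone (axisCount S c) := by
    intro r r' hrr'
    simp only [axisCount]
    exact_mod_cast Set.ncard_le_ncard
      (Set.inter_subset_inter_right _ (Metric.closedBall_subset_closedBall hrr')) (hfinA r')
  have hnn : ∀ r, 0 ≤ axisCount S c r := fun r => by simp only [axisCount]; exact Nat.cast_nonneg _
  have hcub' : ∀ r, 0 ≤ r → axisCount S c r ≤ C₀ * (1 + r) ^ 3 := by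
    intro r hr
    refine le_trans ?_ (hcub c r hr)
    simp only [axisCount]
    exact_mod_cast Set.ncard_le_ncard (Set.inter_subset_inter_left _ hAxS) (hfin c r)
  exact hρ₀ (axisCount S c) hmono hnn hcub' (fun W r hW hr => hlayer c W r hW hr) L hL

/-- **Every site of `ℤ³` is an axis site** (no six-point shell is `1/20`-{fcc,hcp}-good). [folklore] -/
theorem cubic_axisSites_eq : axisSites (Set.range intVec) = Set.range intVec := by
  ext y
  rw [mem_axisSites]
  exact ⟨fun h => h.1, fun hy => ⟨hy, cubic_not_GF y hy⟩⟩

/-- **The layer inequality fails on `ℤ³`**: `LayerInequality (Set.range intVec)` would give density zero of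
the axis sites (`densityZero_of_layerInequality`, `δ = 1`), but on `ℤ³` the axis sites are ALL sites and
`#(ℤ³ ∩ B̄_L(0)) > L³/64` for `L ≥ 8` (`cubic_count_contra`).  Hence the conclusion of the open core stub of
line `Sketch` is not a tautology of profile algebra; its proof must use everywhere-goodness. [folklore] -/
theorem not_layerInequality_cubic : ¬ LayerInequality (Set.range intVec) := by
  intro hL
  obtain ⟨L₀, hL₀⟩ := densityZero_of_layerInequality one_pos cubic_separated hL (1 / 64) (by norm_num)
  have key := hL₀ (max L₀ 8) (le_max_left _ _) 0
  rw [axisCount, ← countedSet_eq] at key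
  exact cubic_count_contra _ (le_max_right L₀ 8) key cubic_not_GF

/-- **The linear axis census fails on `ℤ³`** (via `layerInequality_of_linearAxisCensusAt` and finiteness
of `ℤ³` in balls). [folklore] -/
theorem not_linearAxisCensusAt_cubic : ¬ LinearAxisCensusAt (Set.range intVec) := fun h =>
  not_layerInequality_cubic
    (layerInequality_of_linearAxisCensusAt (stub_dr5_cubic 1 one_pos _ cubic_separated).1 h)

end Summit.AtomisticToContinuum.Crystallization.Theorems.FiveFoldRation.Negative

end
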